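import Summits.ResolutionOfSingularities.ResolutionOfSingularities.Theorems.IndSmoothValuativeSmoothingOfRelLU
import Summits.ResolutionOfSingularities.ResolutionOfSingularities.Theorems.IndSmoothValuativeSmoothingRelLUResidueGeneral
import Summits.ResolutionOfSingularities.ResolutionOfSingularities.Theorems.IndSmoothValuativeSmoothingRelLUResidueRegularCentre
import Literature.AlgebraicGeometry.Resolution.LocalUniformizationAbhyankarPlaces
import HarnessLib

/-!
# The crux `IndSmooth.ValuativeSmoothing` at composite valuations over a uniformizable coarsening
# whose residue valuation has a REGULAR CENTRE OF DIMENSION ≤ 2 (Novacoski–Spivakovsky + Zariski–Abhyankar)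

Support file for crux stmt-ResolutionOfSingularities-16087 (`ValuativeSmoothing`, route file
`Theses/IndSmooth.lean`), lead seat c2 of line `birth` (wave 5): the general form of the
"composite" family, subsuming the rational-residue-surface case
(`…CompositeRationalResidue.lean`).

For `k` perfect (any characteristic), `K/k` finitely generated, valuation rings `O ≤ O₁` of `K`
(`ν = ν₁ ∘ ν₂`) such that
* `ν₁` admits relative local uniformization (`RelLocalUniformization k K O₁`; e.g. `O₁` an
  Abhyankar place / prime divisor), and
* for some finite `s ⊆ O` whose residues generate the residue field of `O₁` (`hres`), the local
  ring of the residue model `k[s̄]` at the centre of `ν₂` — in Novacoski–Spivakovsky's affine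
  language `A_Q / P·A_Q` with `A = k[s]`, `Q = 𝔪_O ∩ A`, `P = 𝔪_{O₁} ∩ A` — is a REGULAR local
  ring of Krull dimension `≤ 2` (`hregQ`, `hdimQ`),
EVERY finitely generated `k`-subalgebra `R ⊆ O` factors `R → T → O` through a smooth `k`-algebra.
Geometrically: `ν₁` uniformizable (e.g. the divisorial valuation of a prime divisor `E` of a
model) and `ν₂` centred at a REGULAR point of (an affine chart of) `E` of codimension `≤ 2` in
`E` — e.g. any valuation of the function field of a three-fold composed of a divisor `E` and a
zero-dimensional valuation of `k(E)` centred at a smooth point of `E` (no rationality of `E`).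

**Proof.** `relLU_of_le_of_relLU_residue` (p170733: Novacoski–Spivakovsky Cor. 2.14 → 2.17 →
§3.1 for this one pair, all PROVED in the tree, after enlarging the model by `s` so that the
comparison map of residue fields is bijective) with its residue input supplied by
`relLU_residue_of_regularCentre` (p170836: transport to the abstract copy of the residue field
and the LU-form of the fourth family, `relLU_of_regularCentre` p169817 — the quadratic sequence
and Abhyankar's union lemma) gives `RelLocalUniformization k K O`;
`smoothFactor_of_relLocalUniformization` (p169280) concludes.

## Sources

* J. Novacoski, M. Spivakovsky, EMS Ser. Congr. Rep. (2014), Cor. 2.14, Cor. 2.17, §3.1.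
  [NovacoskiSpivakovsky2014]
* S. S. Abhyankar, Amer. J. Math. 78 (1956), Lemma 12. [Abhyankar1956Valuations]
* H. Knaf, F.-V. Kuhlmann, Ann. Sci. ÉNS 38 (2005), Thm. 1.1. [KnafKuhlmann2005]
-/

-- single-problem summit: the doubled namespace component is forced
set_option linter.dupNamespace false

namespace Summit.ResolutionOfSingularities.ResolutionOfSingularities.Theorems.ValuativeSmoothing

open IsLocalRing Literature.AlgebraicGeometry.Resolution

/-- **The crux at composite valuations over a uniformizable coarsening whose residue valuation
has a regular centre of dimension `≤ 2` on the residue model.** See the module docstring for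
the hypotheses (`h₁`: relative LU of the coarsening `O₁`; `hres`: the residues of the finite
`s ⊆ O` generate `κ(O₁)`; `hregQ`, `hdimQ`: `A_Q/P·A_Q` regular of dimension `≤ 2` for `A = k[s]`).
Proof: `relLU_of_le_of_relLU_residue` + `relLU_residue_of_regularCentre` give
`RelLocalUniformization k K O`; then `smoothFactor_of_relLocalUniformization`.
[cite: NovacoskiSpivakovsky2014, §3.1] -/
theorem smoothFactor_of_le_of_regularCentreResidue (k K : Type) [Field k] [PerfectField k]
    [Field K] [Algebra k K] (hK : (⊤ : IntermediateField k K).FG) (O O₁ : ValuationSubring K)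
    (hO : O ≤ O₁) (h₁ : RelLocalUniformization k K O₁) (s : Finset K)
    (hA : (Algebra.adjoin k (↑s : Set K)).toSubring ≤ O.toSubring)
    (hres : ∀ z ∈ O₁, ∃ a ∈ Algebra.adjoin k (↑s : Set K), ∃ b ∈ Algebra.adjoin k (↑s : Set K),
      O₁.valuation b = 1 ∧ O₁.valuation (z - a / b) < 1)
    (hregQ : IsRegularLocalRing
      (Localization.AtPrime ((maximalIdeal O).comap (Subring.inclusion hA)) ⧸
        ((maximalIdeal O₁).comap (Subring.inclusion (hA.trans hO))).map
          (algebraMap (Algebra.adjoin k (↑s : Set K)).toSubring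
            (Localization.AtPrime ((maximalIdeal O).comap (Subring.inclusion hA))))))
    (hdimQ : ringKrullDim
      (Localization.AtPrime ((maximalIdeal O).comap (Subring.inclusion hA)) ⧸
        ((maximalIdeal O₁).comap (Subring.inclusion (hA.trans hO))).map
          (algebraMap (Algebra.adjoin k (↑s : Set K)).toSubring
            (Localization.AtPrime ((maximalIdeal O).comap (Subring.inclusion hA))))) ≤ 2)
    (R : Subalgebra k K) (hR : R.FG) (hRO : R.toSubring ≤ O.toSubring) :
    ∃ (T : Type) (_ : CommRing T) (_ : Algebra k T), Algebra.Smooth k T ∧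
      ∃ (ψ : R →ₐ[k] T) (χ : T →ₐ[k] K), (∀ t : T, χ t ∈ O) ∧ ∀ r : R, χ (ψ r) = (r : K) := by
  have hkO : ∀ c : k, algebraMap k K c ∈ O := fun c => hA ((Algebra.adjoin k _).algebraMap_mem c)
  have hk : ∀ c : k, algebraMap k K c ∈ O₁ := fun c => hO (hkO c)
  have hs : (↑s : Set K) ⊆ O := fun z hz => hA (Algebra.subset_adjoin hz)
  have hLU : RelLocalUniformization k K O :=
    relLU_of_le_of_relLU_residue k K O O₁ hO hk h₁ s hs hres
      (fun κ _ _ ι hι hιk => relLU_residue_of_regularCentre k K O O₁ hO hk s hA hres hregQ hdimQ κ ι hι hιk)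
  exact smoothFactor_of_relLocalUniformization k K hK O hkO hLU R hR hRO

/-- **The crux at composites of an ABHYANKAR place (e.g. a prime divisor) with a valuation of
its residue field centred at a regular point of dimension `≤ 2` of the residue model** — the
previous theorem with `h₁` discharged by Knaf–Kuhlmann's relative local uniformization at
Abhyankar places over a perfect field (`relLU_at_abhyankarPlace_of_perfectField`, proved in the
tree). [cite: KnafKuhlmann2005, Thm. 1.1 and Cor. 2.2] -/
theorem smoothFactor_of_le_abhyankarPlace_of_regularCentreResidue (k K : Type) [Field k]
    [PerfectField k] [Field K] [Algebra k K] (hK : (⊤ : IntermediateField k K).FG)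
    (O O₁ : ValuationSubring K) (hO : O ≤ O₁)
    (hAbh : IsAbhyankarPlace O₁ (algebraMap k K).fieldRange ⊤) (s : Finset K)
    (hA : (Algebra.adjoin k (↑s : Set K)).toSubring ≤ O.toSubring)
    (hres : ∀ z ∈ O₁, ∃ a ∈ Algebra.adjoin k (↑s : Set K), ∃ b ∈ Algebra.adjoin k (↑s : Set K),
      O₁.valuation b = 1 ∧ O₁.valuation (z - a / b) < 1)
    (hregQ : IsRegularLocalRing
      (Localization.AtPrime ((maximalIdeal O).comap (Subring.inclusion hA)) ⧸
        ((maximalIdeal O₁).comap (Subring.inclusion (hA.trans hO))).map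
          (algebraMap (Algebra.adjoin k (↑s : Set K)).toSubring
            (Localization.AtPrime ((maximalIdeal O).comap (Subring.inclusion hA))))))
    (hdimQ : ringKrullDim
      (Localization.AtPrime ((maximalIdeal O).comap (Subring.inclusion hA)) ⧸
        ((maximalIdeal O₁).comap (Subring.inclusion (hA.trans hO))).map
          (algebraMap (Algebra.adjoin k (↑s : Set K)).toSubring
            (Localization.AtPrime ((maximalIdeal O).comap (Subring.inclusion hA))))) ≤ 2)
    (R : Subalgebra k K) (hR : R.FG) (hRO : R.toSubring ≤ O.toSubring) :
    ∃ (T : Type) (_ : CommRing T) (_ : Algebra k T), Algebra.Smooth k T ∧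
      ∃ (ψ : R →ₐ[k] T) (χ : T →ₐ[k] K), (∀ t : T, χ t ∈ O) ∧ ∀ r : R, χ (ψ r) = (r : K) := by
  have hk : ∀ c : k, algebraMap k K c ∈ O₁ :=
    fun c => hO (hA ((Algebra.adjoin k _).algebraMap_mem c))
  have h₁ : RelLocalUniformization k K O₁ := by
    intro R' hR' _ hR'O₁
    obtain ⟨A, hA', hR'A, hAfg, -, hreg⟩ :=
      relLU_at_abhyankarPlace_of_perfectField hK O₁ hk hAbh R' hR' hR'O₁
    exact ⟨A, hA', hR'A, hAfg, hreg⟩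
  exact smoothFactor_of_le_of_regularCentreResidue k K hK O O₁ hO h₁ s hA hres hregQ hdimQ R hR hRO

end Summit.ResolutionOfSingularities.ResolutionOfSingularities.Theorems.ValuativeSmoothing
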